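import Summits.ABC.IUTFork.Cor312RegimeVerbatimPrVolNeg
import Literature.IUT.LogVolume.TensorPacketSlotUnion
import HarnessLib

/-!
# [IUTchIII] Cor. 3.12 — the regime dichotomy at the print-normalised sharp setting of record made EXACT, I:
# LOCALITY of the local Θ-terms and the decomposition `−|log(Θ)|(t) = −|log(Θ)|(𝟙) + Θside`

PROOF-ONLY support piece of the abc-iut cell (Cor. 3.12 cone, D-0067; seat abc-iut-w4-d107, gen 5; part 11 of the
`Cor312NegLogThetaUpperPrVol*` / `Cor312RegimeVerbatimPrVol*` chain, sequel of part 8 `Cor312RegimeVerbatimPrVolNeg`,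
p437123). TAKES NO SIDE on [IUTchIII] Cor. 3.12; theorems only, 0 `def`s, no new `Prop` fact, no instance.

Setting: abc-iut-c312-7's `Real.settingPrVolSharp` (Θ-boxes `ι_j(t_{Θ,j,v_j})·(R_I)^∼` and `q`-centre READ OFF pilot
ideles; no re-gluing), pilot data `X` whose places of `S` all lie over a finite set `U` of ODD primes UNRAMIFIED in `F`,
Θ-exponents `‖t_{Θ,i+1,v}‖ = ‖p^{m_{i,p}(v)}‖` and `q`-exponents `‖t_{q,v}‖ = ‖p^{m_{q,p}(v)}‖` over `U`;
`Θside := PN_i Σ_{p∈U} Σ_{v⃗} Pr(v⃗)·(−min_a m_{i,p}(v⃗ a)·log p)` (abc-iut-c312-5's exact local hull value p433308,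
slot-symmetrised), `Qside := PN_i Σ_{p∈U} Σ_{v⃗} Pr(v⃗)·(−m_{q,p}(v⃗(last))·log p)`; `𝟙` = the TRIVIAL (unit) Θ- and
`q`-ideles at the SAME context binders.

Part 8 decided the typed Statement by the sign of `Qside − Θside` UP TO a constant `C₂ ≥ 0` of the primes `2` and
`p | disc(F)` (`settingPrVolSharp_regime_dichotomy`: `Qside ≤ Θside ⟹ Statement`, `Θside + C₂ < Qside ⟹ ¬Statement`),
leaving the band `Θside < Qside ≤ Θside + C₂` undecided. THIS FILE and its sequel (part 12,
`Cor312RegimeVerbatimPrVolExactCriterion`: the criterion `Statement ⟺ ↑(Qside − Θside) ≤ −|log(Θ)|(𝟙)`) remove the band: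

* §1 LOCALITY `thetaLocal_settingPrVolSharp_inr_eq_of_norm_eq_at` — the local Θ-term `−|log(Θ)|_{j,p}` of
  `settingPrVolSharp` at a packet `(j, p)` reads the Θ-ideles ONLY through their absolute values OVER `p`, and does not
  read the `q`-ideles at all (per-packet form of abc-iut-C-cert-2's `sharpBoxDH_eq_of_norm_eq` /
  `settingPrVolSharp_eq_of_norm_eq`, Cor312PilotIdelesPrInvariance: a slot unit does not move `(R_I)^∼`, abc-iut-S1
  `iota_smul_normalizedPacket_eq_of_norm_eq_one`; and the hull frame, the (Ind1)/(Ind2)-orbit and the container at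
  `(j, p)` read only the Θ-box at `(j, p)`, `thetaLocal_settingPrVol_congr_thetaBox`);
* §2 EXACT DECOMPOSITION **`negLogTheta_settingPrVolSharp_eq_trivial_add_exact`** —
  `−|log(Θ)|(t_q, t) = −|log(Θ)|(𝟙) + Θside(m)` for EVERY context, every such Θ-ideles and ANY `q`-ideles: at `U` the
  value is c312-5's exact one (`0` for `𝟙`, `thetaLocal_untopD_settingPrVolSharp_trivial_eq_zero`), at every other
  prime the Θ-boxes of `t` and of `𝟙` are unit boxes with the SAME local term (§1), at `∞` both terms vanish; so the
  hull inflation at the exceptional primes `2`, `p | disc(F)` — the whole non-explicit part of `−|log(Θ)|` — is ONE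
  datum-independent real number `−|log(Θ)|(𝟙)` (`negLogTheta_settingPrVolSharp_trivial_ne_top`; the sequel bounds it
  by `0 ≤ −|log(Θ)|(𝟙) ≤ C₂` and states the criterion).
HONEST SCOPE as in parts 7–10: (Ind2) as typed at the real setting (`Real.ismDH`); sharp (Ind3) reading; trivial
archimedean container; free ideles (realising ideles of an initial Θ-datum exist iff `2l ∣ ord_v(q_v)`, plan C-R16); the
positive instances are inflation-dominated and say nothing about print's intended content; nothing here asserts or
denies [IUTchIII] Cor. 3.12 for initial Θ-data. typed ≠ proved; instantiated ≠ endorsed.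
[claim: Mochizuki2012, status: disputed] [cite: DupuyHilado2025, §3.6, §3.7, §3.9, §4.7, §4.9, §4.10]
[cite: Mochizuki2012, IUTchIV Thm. 1.10 Step (v) p. 27] [cite: ScholzeStix2018, §2.2 pp. 9–10]
-/

noncomputable section

open Set Function NumberField IsDedekindDomain
open scoped Pointwise

namespace Summit.ABC

namespace IUTFork

namespace Thm311

namespace Real

open Cor312 Cor312.Setting Cor312Vol Literature.IUT.LogThetaLattice Literature.IUT.LogVolume

variable {F : Type} [Field F] [NumberField F] (X : PilotData F) {logv : PadicLogs F} (hlog : LogvAnalytic logv)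

/-! ## §1. Locality: the local Θ-term at `(j, p)` reads only the Θ-idele norms over `p` -/

section Locality

variable (t t' : ∀ (pp : Nat.Primes) (_ : Fin X.lstar) (x : (thetaIndex X).Fibre (.inr pp)),
    haveI : Fact (pp : ℕ).Prime := ⟨pp.2⟩; kOf X pp.1 x)

/-- At a fixed prime `p`, the label idele has the same absolute value for two Θ-idele families with the same absolute
values OVER `p`. [cite: DupuyHilado2025, §3.9] -/
theorem norm_labelIdele_eq_of_norm_eq_at (pp : Nat.Primes) (h : ∀ i x, ‖t pp i x‖ = ‖t' pp i x‖)
    (j : (thetaIndex X).Label) (x : (thetaIndex X).Fibre (.inr pp)) :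
    ‖labelIdele X t pp j x‖ = ‖labelIdele X t' pp j x‖ := by
  unfold labelIdele
  split_ifs
  · exact h _ _
  · rfl

/-- **The sharp Θ-boxes `ι_j(t_{Θ,j,v_j})·(R_I)^∼` over a prime `p` depend on the Θ-ideles only through their absolute
values OVER `p`** (per-prime form of abc-iut-C-cert-2's `sharpBoxDH_eq_of_norm_eq`: a slot unit does not move `(R_I)^∼`,
abc-iut-S1 `iota_smul_normalizedPacket_eq_of_norm_eq_one`). [cite: DupuyHilado2025, §3.7, §3.9]
[cite: Mochizuki2012, IUTchIV Thm. 1.10 Step (v) p. 27] -/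
theorem sharpBoxDH_eq_of_norm_eq_at (ht0 : ∀ pp i x, t pp i x ≠ 0) (pp : Nat.Primes)
    (h : ∀ i x, ‖t pp i x‖ = ‖t' pp i x‖) (j : (thetaIndex X).Label)
    (e : (thetaIndex X).Caps j → (thetaIndex X).Fibre (.inr pp)) :
    sharpBoxDH X hlog t pp j e = sharpBoxDH X hlog t' pp j e := by
  haveI : Fact (pp : ℕ).Prime := ⟨pp.2⟩
  have ha : labelIdele X t pp j (e (Fin.last _)) ≠ 0 := labelIdele_ne_zero X t ht0 pp j _
  have hn := norm_labelIdele_eq_of_norm_eq_at X t t' pp h j (e (Fin.last _))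
  have hna : ‖labelIdele X t pp j (e (Fin.last _))‖ ≠ 0 := norm_ne_zero_iff.mpr ha
  have hu : ‖(labelIdele X t pp j (e (Fin.last _)))⁻¹ * labelIdele X t' pp j (e (Fin.last _))‖ = 1 := by
    rw [norm_mul, norm_inv, ← hn, inv_mul_cancel₀ hna]
  have hdec : labelIdele X t' pp j (e (Fin.last _)) =
      labelIdele X t pp j (e (Fin.last _)) *
        ((labelIdele X t pp j (e (Fin.last _)))⁻¹ * labelIdele X t' pp j (e (Fin.last _))) := by
    rw [mul_inv_cancel_left₀ ha]
  -- `ι(t') = ι(t)·ι(u)` with `u = t⁻¹·t'` a unit, and `ι(u)·(R_I)^∼ = (R_I)^∼`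
  have hmul : iota (pp : ℕ) ((presAt X hlog pp).kk e) (Fin.last _) (labelIdele X t' pp j (e (Fin.last _))) =
      iota (pp : ℕ) ((presAt X hlog pp).kk e) (Fin.last _) (labelIdele X t pp j (e (Fin.last _))) *
        iota (pp : ℕ) ((presAt X hlog pp).kk e) (Fin.last _)
          ((labelIdele X t pp j (e (Fin.last _)))⁻¹ * labelIdele X t' pp j (e (Fin.last _))) := by
    conv_lhs => rw [hdec]
    exact map_mul _ _ _
  have key : iota (pp : ℕ) ((presAt X hlog pp).kk e) (Fin.last _) (labelIdele X t' pp j (e (Fin.last _))) •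
        (normalizedPacket (pp : ℕ) ((presAt X hlog pp).kk e) :
          Set (PacketAlgebra (pp : ℕ) ((presAt X hlog pp).kk e))) =
      iota (pp : ℕ) ((presAt X hlog pp).kk e) (Fin.last _) (labelIdele X t pp j (e (Fin.last _))) •
        (normalizedPacket (pp : ℕ) ((presAt X hlog pp).kk e) :
          Set (PacketAlgebra (pp : ℕ) ((presAt X hlog pp).kk e))) := by
    rw [hmul, ← smul_smul,
      iota_smul_normalizedPacket_eq_of_norm_eq_one (pp : ℕ) ((presAt X hlog pp).kk e) (Fin.last _) hu]
  exact key.symm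

variable (M : Type) [Field M] [NumberField M]
  (archPk : ∀ (j : (thetaIndex X).Label) (vQ : (thetaIndex X).VQ), Set ((logShellsDH X logv).Packet j vQ))
  (archSub : ∀ (j : (thetaIndex X).Label) (v : (thetaIndex X).V),
    Set ((logShellsDH X logv).Packet j ((thetaIndex X).over v)))
  (Ψ : ℤ → ∀ v : (thetaIndex X).V, v ∈ (thetaIndex X).Vbad → Set ((logShellsDH X logv).StarPacket v))
  (act : ℤ → ∀ v : (thetaIndex X).V, v ∈ (thetaIndex X).Vbad →
    (logShellsDH X logv).StarPacket v → Module.End ℚ ((logShellsDH X logv).StarPacket v))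
  (Mmod : ℤ → ∀ j : (thetaIndex X).LabelStar, Set ((logShellsDH X logv).GlobalPacket j.1))
  (region : ℤ → ∀ j : (thetaIndex X).LabelStar, FinDivisor M → ∀ vQ : (thetaIndex X).VQ,
    Set ((logShellsDH X logv).Packet j.1 vQ))
  (n : ℤ) {HT : Type} {LogLink : HT → HT → Type} {IsFull : ∀ {s t : HT}, LogLink s t → Prop}
  (lat : LGPGaussianLogThetaLattice LogLink IsFull)
  {Frd : Type} {IsoF : Frd → Frd → Type} {Ob : Frd → Type} {realify : Frd → Frd} {Strip : Type}
  {IsoS : Strip → Strip → Type} {Mv : ∀ v : (thetaIndex X).V, v ∈ (thetaIndex X).Vbad → Type}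
  [∀ v h, Monoid (Mv v h)]
  (sig : GlobalLGPFrobenioidSignature (thetaIndex X).lstar (thetaIndex X).V (· ∈ (thetaIndex X).Vbad)
    Frd IsoF Ob realify Strip IsoS Mv)
  (split : SplittingMonoids Mv) {ObΔ : Type} {N : ∀ v : (thetaIndex X).V, v ∈ (thetaIndex X).Vbad → Type}
  [∀ v h, Monoid (N v h)] (qData : QPilotData ObΔ N)

/-- **The local Θ-term of abc-iut-c312-1's assembled real setting at `(j, v_ℚ)` reads the Θ-box binder only at
`(j, v_ℚ)`** (and the `q`-centre binder not at all): the hull frame, the (Ind1)/(Ind2)-orbit of the (Ind3)-region, the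
holomorphic hull and its log-volume at `(j, v_ℚ)` are assembled from the Θ-boxes at `(j, v_ℚ)` alone
(`Setting.ofComparison`). [folklore] -/
theorem thetaLocal_settingPrVol_congr_thetaBox
    {thetaBox thetaBox' : ℤ → Ob sig.Clgp → ∀ (j : (thetaIndex X).Label) (vQ : (thetaIndex X).VQ),
      Set (∀ s : factorIdxDH X hlog j vQ, factorFieldDH X hlog j vQ s)}
    {qCentre qCentre' : ObΔ → ∀ (j : (thetaIndex X).Label) (vQ : (thetaIndex X).VQ),
      ∀ s : factorIdxDH X hlog j vQ, factorFieldDH X hlog j vQ s}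
    {hq : ∀ j vQ s, qCentre (qPilotObject qData) j vQ s ≠ 0} {hq' : ∀ j vQ s, qCentre' (qPilotObject qData) j vQ s ≠ 0}
    {hfin : ∀ j : (thetaIndex X).Label, (Function.support fun vQ =>
      ((situationPrVol X hlog M archPk archSub Ψ act Mmod region).D n).logvol j vQ
        (factorMapDH X hlog j vQ ⁻¹' hullSet (factorFieldDH X hlog j vQ) (qCentre (qPilotObject qData) j vQ))).Finite}
    {hfin' : ∀ j : (thetaIndex X).Label, (Function.support fun vQ =>
      ((situationPrVol X hlog M archPk archSub Ψ act Mmod region).D n).logvol j vQ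
        (factorMapDH X hlog j vQ ⁻¹' hullSet (factorFieldDH X hlog j vQ) (qCentre' (qPilotObject qData) j vQ))).Finite}
    (j : (thetaIndex X).Label) (vQ : (thetaIndex X).VQ)
    (h : ∀ (m : ℤ) (o : Ob sig.Clgp), thetaBox m o j vQ = thetaBox' m o j vQ) :
    (settingPrVol X hlog M archPk archSub Ψ act Mmod region n lat sig split qData thetaBox qCentre hq hfin).thetaLocal
        j vQ =
      (settingPrVol X hlog M archPk archSub Ψ act Mmod region n lat sig split qData thetaBox' qCentre' hq'
        hfin').thetaLocal j vQ := by
  have h3 : (settingPrVol X hlog M archPk archSub Ψ act Mmod region n lat sig split qData thetaBox qCentre hq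
        hfin).thetaRegion3 j vQ =
      (settingPrVol X hlog M archPk archSub Ψ act Mmod region n lat sig split qData thetaBox' qCentre' hq'
        hfin').thetaRegion3 j vQ := by
    unfold Setting.thetaRegion3
    refine Set.iUnion_congr fun m => ?_
    show factorMapDH X hlog j vQ ⁻¹' thetaBox m (thetaPilotObject sig split) j vQ =
      factorMapDH X hlog j vQ ⁻¹' thetaBox' m (thetaPilotObject sig split) j vQ
    rw [h]
  have hPI : (settingPrVol X hlog M archPk archSub Ψ act Mmod region n lat sig split qData thetaBox qCentre hq
        hfin).possibleImages j vQ =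
      (settingPrVol X hlog M archPk archSub Ψ act Mmod region n lat sig split qData thetaBox' qCentre' hq'
        hfin').possibleImages j vQ := by
    unfold Setting.possibleImages
    rw [h3]
  unfold Setting.thetaLocal Setting.HullDefined Setting.thetaHull
  rw [hPI]
  rfl

variable (tq tq' : ∀ (pp : Nat.Primes) (x : (thetaIndex X).Fibre (.inr pp)), haveI : Fact (pp : ℕ).Prime := ⟨pp.2⟩;
    kOf X pp.1 x)

/-- **LOCALITY of the local Θ-term of the sharp setting of record.** `−|log(Θ)|_{j,p}` of `Real.settingPrVolSharp`
at the packet `(j, p)` is the SAME for two Θ-idele families with the same absolute values OVER `p` — whatever the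
Θ-ideles elsewhere and whatever the `q`-ideles: the Θ-box at `(j, p)` is `Π_{v⃗} ι_j(t_{Θ,j,v⃗(last)})·(R_{v⃗})^∼`
(Dupuy–Hilado §3.9), a unit of the last tensor factor does not move `(R_{v⃗})^∼` ([IUTchIV] Thm. 1.10 Step (v)), and
the hull frame, the (Ind1)/(Ind2)-orbit and the container volume at `(j, p)` read nothing else.
[cite: DupuyHilado2025, §3.7, §3.9, §4.9] [cite: Mochizuki2012, IUTchIV Thm. 1.10 Step (v) p. 27] -/
theorem thetaLocal_settingPrVolSharp_inr_eq_of_norm_eq_at (ht0 : ∀ pp i x, t pp i x ≠ 0)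
    (htq0 : ∀ pp x, tq pp x ≠ 0)
    (htq1 : ∀ (pp : Nat.Primes) (x : (thetaIndex X).Fibre (.inr pp)),
      haveI : Fact (pp : ℕ).Prime := ⟨pp.2⟩; placeOf X pp.1 x ∉ X.S → ‖tq pp x‖ = 1)
    (htq0' : ∀ pp x, tq' pp x ≠ 0)
    (htq1' : ∀ (pp : Nat.Primes) (x : (thetaIndex X).Fibre (.inr pp)),
      haveI : Fact (pp : ℕ).Prime := ⟨pp.2⟩; placeOf X pp.1 x ∉ X.S → ‖tq' pp x‖ = 1)
    (pp : Nat.Primes) (h : ∀ i x, ‖t pp i x‖ = ‖t' pp i x‖) (j : (thetaIndex X).Label) :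
    (settingPrVolSharp X hlog M archPk archSub Ψ act Mmod region n lat sig split qData tq t htq0 htq1).thetaLocal j
        (.inr pp) =
      (settingPrVolSharp X hlog M archPk archSub Ψ act Mmod region n lat sig split qData tq' t' htq0' htq1').thetaLocal
        j (.inr pp) := by
  have hbox : sharpBoxDH X hlog t pp j = sharpBoxDH X hlog t' pp j :=
    funext fun e => sharpBoxDH_eq_of_norm_eq_at X hlog t t' ht0 pp h j e
  unfold settingPrVolSharp
  refine thetaLocal_settingPrVol_congr_thetaBox X hlog M archPk archSub Ψ act Mmod region n lat sig split qData j
    (.inr pp) fun m o => ?_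
  haveI : Fact (pp : ℕ).Prime := ⟨pp.2⟩
  show (presAt X hlog pp).boxOf (sharpBoxDH X hlog t pp j) = (presAt X hlog pp).boxOf (sharpBoxDH X hlog t' pp j)
  rw [hbox]

end Locality

/-! ## §2. The exact decomposition `−|log(Θ)|(t) = −|log(Θ)|(𝟙) + Θside` -/

section Exact

variable (M : Type) [Field M] [NumberField M]
  (archPk : ∀ (j : (thetaIndex X).Label) (vQ : (thetaIndex X).VQ), Set ((logShellsDH X logv).Packet j vQ))
  (archSub : ∀ (j : (thetaIndex X).Label) (v : (thetaIndex X).V),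
    Set ((logShellsDH X logv).Packet j ((thetaIndex X).over v)))
  (Ψ : ℤ → ∀ v : (thetaIndex X).V, v ∈ (thetaIndex X).Vbad → Set ((logShellsDH X logv).StarPacket v))
  (act : ℤ → ∀ v : (thetaIndex X).V, v ∈ (thetaIndex X).Vbad →
    (logShellsDH X logv).StarPacket v → Module.End ℚ ((logShellsDH X logv).StarPacket v))
  (Mmod : ℤ → ∀ j : (thetaIndex X).LabelStar, Set ((logShellsDH X logv).GlobalPacket j.1))
  (region : ℤ → ∀ j : (thetaIndex X).LabelStar, FinDivisor M → ∀ vQ : (thetaIndex X).VQ,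
    Set ((logShellsDH X logv).Packet j.1 vQ))
  (n : ℤ) {HT : Type} {LogLink : HT → HT → Type} {IsFull : ∀ {s t : HT}, LogLink s t → Prop}
  (lat : LGPGaussianLogThetaLattice LogLink IsFull)
  {Frd : Type} {IsoF : Frd → Frd → Type} {Ob : Frd → Type} {realify : Frd → Frd} {Strip : Type}
  {IsoS : Strip → Strip → Type} {Mv : ∀ v : (thetaIndex X).V, v ∈ (thetaIndex X).Vbad → Type}
  [∀ v h, Monoid (Mv v h)]
  (sig : GlobalLGPFrobenioidSignature (thetaIndex X).lstar (thetaIndex X).V (· ∈ (thetaIndex X).Vbad)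
    Frd IsoF Ob realify Strip IsoS Mv)
  (split : SplittingMonoids Mv) {ObΔ : Type} {N : ∀ v : (thetaIndex X).V, v ∈ (thetaIndex X).Vbad → Type}
  [∀ v h, Monoid (N v h)] (qData : QPilotData ObΔ N)
  (t : ∀ (pp : Nat.Primes) (_ : Fin X.lstar) (x : (thetaIndex X).Fibre (.inr pp)),
    haveI : Fact (pp : ℕ).Prime := ⟨pp.2⟩; kOf X pp.1 x)
  (tq : ∀ (pp : Nat.Primes) (x : (thetaIndex X).Fibre (.inr pp)), haveI : Fact (pp : ℕ).Prime := ⟨pp.2⟩; kOf X pp.1 x)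

/-- The exact Θ-term on `U` vanishes for the zero exponents (the trivial ideles `𝟙`). [folklore] -/
theorem sum_weightPr_mul_inf'_zero_eq_zero (i : Fin (thetaIndex X).lstar) (pp : Nat.Primes) :
    haveI : Fact (pp : ℕ).Prime := ⟨pp.2⟩
    ∑ e : (presAt X hlog pp).toLocalPieces.E (Setting.labelSucc i),
        weightPr X pp.1 (Setting.labelSucc i) e *
          (-(Finset.univ.inf' Finset.univ_nonempty (fun _ : (thetaIndex X).Caps (Setting.labelSucc i) => (0 : ℤ)) *
            Real.log (pp : ℕ))) = 0 := by
  haveI : Fact (pp : ℕ).Prime := ⟨pp.2⟩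
  refine Finset.sum_eq_zero fun e _ => ?_
  rw [Finset.inf'_const, Int.cast_zero, zero_mul, neg_zero, mul_zero]

/-- **The local Θ-term of the TRIVIAL configuration at an odd unramified packet is `0`** (abc-iut-c312-5's exact value at
the zero exponents). [cite: DupuyHilado2025, §3.6, §3.9] -/
theorem thetaLocal_untopD_settingPrVolSharp_trivial_eq_zero (i : Fin (thetaIndex X).lstar) (pp : Nat.Primes)
    (hp2 : 2 < (pp : ℕ)) (hdisc : ¬ ((pp : ℕ) : ℤ) ∣ NumberField.discr F) :
    ((settingPrVolSharp X hlog M archPk archSub Ψ act Mmod region n lat sig split qData (fun _ _ => 1) (fun _ _ _ => 1)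
        (fun _ _ => one_ne_zero) (fun _ _ _ => norm_one)).thetaLocal (Setting.labelSucc i) (.inr pp)).untopD 0 = 0 := by
  haveI : Fact (pp : ℕ).Prime := ⟨pp.2⟩
  rw [thetaLocal_untopD_settingPrVolSharp_eq_of_zpow X hlog M archPk archSub Ψ act Mmod region n lat sig split qData
    (fun _ _ _ => 1) (fun _ _ => 1) (fun _ _ _ => one_ne_zero) (fun _ _ => one_ne_zero) (fun _ _ _ => norm_one) i pp hp2
    hdisc (fun _ => 0) (fun x => by simp)]
  exact sum_weightPr_mul_inf'_zero_eq_zero X hlog i pp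

/-- **THE EXACT DECOMPOSITION.** For pilot data whose places of `S` lie over a finite set `U` of odd primes unramified in
`F`, Θ-ideles `t` (non-zero, units off `S`) with exponents `‖t_{Θ,i+1,v}‖ = ‖p^{m_{i,p}(v)}‖` over `U` and ANY
`q`-ideles `t_q` (non-zero, units off `S`):
`−|log(Θ)|(t_q, t) = −|log(Θ)|(𝟙) + PN_i Σ_{p∈U} Σ_{v⃗} Pr(v⃗)·(−min_a m_{i,p}(v⃗ a)·log p)`,
where `𝟙` denotes the trivial (unit) ideles at the same context binders: exact at `U` (abc-iut-c312-5), equal local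
terms at every other prime (§1: unit boxes on both sides), `0` at `∞`. The ENTIRE non-explicit part of `−|log(Θ)|` — the
hull inflation of the unit boxes at `2` and at the primes dividing `disc(F)` — is the one datum-independent number
`−|log(Θ)|(𝟙)`. [cite: DupuyHilado2025, §3.6, §3.9, §4.7, §4.9] [claim: Mochizuki2012, status: disputed] -/
theorem negLogTheta_settingPrVolSharp_eq_trivial_add_exact (ht0 : ∀ pp i x, t pp i x ≠ 0)
    (ht1 : ∀ (pp : Nat.Primes) (i : Fin X.lstar) (x : (thetaIndex X).Fibre (.inr pp)),
      haveI : Fact (pp : ℕ).Prime := ⟨pp.2⟩; placeOf X pp.1 x ∉ X.S → ‖t pp i x‖ = 1)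
    (htq0 : ∀ pp x, tq pp x ≠ 0)
    (htq1 : ∀ (pp : Nat.Primes) (x : (thetaIndex X).Fibre (.inr pp)),
      haveI : Fact (pp : ℕ).Prime := ⟨pp.2⟩; placeOf X pp.1 x ∉ X.S → ‖tq pp x‖ = 1)
    (U : Finset Nat.Primes)
    (hU : ∀ (pp : Nat.Primes) (x : (thetaIndex X).Fibre (.inr pp)),
      haveI : Fact (pp : ℕ).Prime := ⟨pp.2⟩; placeOf X pp.1 x ∈ X.S → pp ∈ U)
    (hU2 : ∀ pp ∈ U, 2 < (pp : ℕ)) (hUd : ∀ pp ∈ U, ¬ ((pp : ℕ) : ℤ) ∣ NumberField.discr F)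
    (m : ∀ pp : Nat.Primes, Fin (thetaIndex X).lstar → (thetaIndex X).Fibre (.inr pp) → ℤ)
    (hm : ∀ (pp : Nat.Primes), pp ∈ U → ∀ (i : Fin (thetaIndex X).lstar) (x : (thetaIndex X).Fibre (.inr pp)),
      haveI : Fact (pp : ℕ).Prime := ⟨pp.2⟩; ‖t pp i x‖ = ‖((pp : ℕ) : ℚ_[pp]) ^ m pp i x‖) :
    (settingPrVolSharp X hlog M archPk archSub Ψ act Mmod region n lat sig split qData tq t htq0 htq1).negLogTheta =
      (settingPrVolSharp X hlog M archPk archSub Ψ act Mmod region n lat sig split qData (fun _ _ => 1) (fun _ _ _ => 1)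
          (fun _ _ => one_ne_zero) (fun _ _ _ => norm_one)).negLogTheta +
        ((processionNormalized (fun i : Fin (thetaIndex X).lstar => ∑ pp ∈ U,
          (haveI : Fact (pp : ℕ).Prime := ⟨pp.2⟩;
            ∑ e : (presAt X hlog pp).toLocalPieces.E (Setting.labelSucc i),
              weightPr X pp.1 (Setting.labelSucc i) e *
                (-(Finset.univ.inf' Finset.univ_nonempty (fun a => m pp i (e a)) * Real.log (pp : ℕ))))) : ℝ) :
          WithTop ℝ) := by
  have hfinΘ := thetaFinite_settingPrVolSharp X hlog M archPk archSub Ψ act Mmod region n lat sig split qData t tq ht0 ht1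
    htq0 htq1
  have hfinΘ₁ := thetaFinite_settingPrVolSharp X hlog M archPk archSub Ψ act Mmod region n lat sig split qData
    (fun _ _ _ => 1) (fun _ _ => 1) (fun _ _ _ => one_ne_zero) (fun _ _ _ _ => norm_one) (fun _ _ => one_ne_zero)
    (fun _ _ _ => norm_one)
  have H := bridgeHyps_settingPrVolSharp_of_ideles X hlog M archPk archSub Ψ act Mmod region n lat sig split qData t tq ht0
    ht1 htq0 htq1
  have H₁ := bridgeHyps_settingPrVolSharp_of_ideles X hlog M archPk archSub Ψ act Mmod region n lat sig split qData
    (fun _ _ _ => 1) (fun _ _ => 1) (fun _ _ _ => one_ne_zero) (fun _ _ _ _ => norm_one) (fun _ _ => one_ne_zero)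
    (fun _ _ _ => norm_one)
  have hunit : ∀ (pp : Nat.Primes), pp ∉ U → ∀ (i : Fin (thetaIndex X).lstar) (x : (thetaIndex X).Fibre (.inr pp)),
      ‖t pp i x‖ = 1 := fun pp hpp i x => ht1 pp i x fun hS => hpp (hU pp x hS)
  unfold Setting.negLogTheta
  rw [if_pos hfinΘ, if_pos hfinΘ₁, ← WithTop.coe_add, WithTop.coe_inj]
  have hadd : ∀ f g : Fin (thetaIndex X).lstar → ℝ,
      processionNormalized f + processionNormalized g = processionNormalized (fun i => f i + g i) := fun f g => by
    unfold processionNormalized; rw [Finset.sum_add_distrib, add_div]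
  rw [hadd]
  refine congrArg processionNormalized (funext fun i => ?_)
  -- the correction on `U`: the exact term, `0` elsewhere
  let g : (thetaIndex X).VQ → ℝ := fun vQ =>
    match vQ with
    | .inl _ => 0
    | .inr pp => if pp ∈ U then
        (haveI : Fact (pp : ℕ).Prime := ⟨pp.2⟩;
          ∑ e : (presAt X hlog pp).toLocalPieces.E (Setting.labelSucc i),
            weightPr X pp.1 (Setting.labelSucc i) e *
              (-(Finset.univ.inf' Finset.univ_nonempty (fun a => m pp i (e a)) * Real.log (pp : ℕ))))
      else 0
  have hg_supp : (Function.support g) ⊆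
      ((U.map ⟨(Sum.inr : Nat.Primes → (thetaIndex X).VQ), fun _ _ h => Sum.inr_injective h⟩ :
        Finset (thetaIndex X).VQ) : Set (thetaIndex X).VQ) := by
    intro vQ hvQ
    rw [Function.mem_support] at hvQ
    rcases vQ with u | pp
    · exact absurd rfl hvQ
    · rw [Finset.coe_map, Set.mem_image]
      by_cases hpp : pp ∈ U
      · exact ⟨pp, Finset.mem_coe.mpr hpp, rfl⟩
      · exact absurd (by show g (.inr pp) = 0; exact if_neg hpp) hvQ
  have hg_fin : (Function.support g).Finite := (Finset.finite_toSet _).subset hg_supp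
  have hsum : ∑ᶠ vQ, g vQ = ∑ pp ∈ U,
      (haveI : Fact (pp : ℕ).Prime := ⟨pp.2⟩;
        ∑ e : (presAt X hlog pp).toLocalPieces.E (Setting.labelSucc i),
          weightPr X pp.1 (Setting.labelSucc i) e *
            (-(Finset.univ.inf' Finset.univ_nonempty (fun a => m pp i (e a)) * Real.log (pp : ℕ)))) := by
    rw [finsum_eq_sum_of_support_subset g hg_supp, Finset.sum_map]
    exact Finset.sum_congr rfl fun pp hpp => if_pos hpp
  rw [← hsum, ← finsum_add_distrib (hfinΘ₁.2 i) hg_fin]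
  refine finsum_congr fun vQ => ?_
  rcases vQ with u | pp
  · -- at `∞`: both local terms vanish
    show _ = _ + (0 : ℝ)
    rw [add_zero]
    exact (thetaLocal_settingPrVol_untopD_inl X hlog M archPk archSub Ψ act Mmod region n lat sig split qData _ _ _ _ u i
      H).trans (thetaLocal_settingPrVol_untopD_inl X hlog M archPk archSub Ψ act Mmod region n lat sig split qData _ _ _ _ u
        i H₁).symm
  · haveI : Fact (pp : ℕ).Prime := ⟨pp.2⟩
    by_cases hpp : pp ∈ U
    · -- at `U`: exact for `t`, `0` for `𝟙`
      rw [show g (.inr pp) = _ from if_pos hpp,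
        thetaLocal_untopD_settingPrVolSharp_eq_of_zpow X hlog M archPk archSub Ψ act Mmod region n lat sig split qData t
          tq ht0 htq0 htq1 i pp (hU2 pp hpp) (hUd pp hpp) (m pp i) (hm pp hpp i),
        thetaLocal_untopD_settingPrVolSharp_trivial_eq_zero X hlog M archPk archSub Ψ act Mmod region n lat sig split
          qData i pp (hU2 pp hpp) (hUd pp hpp), zero_add]
    · -- off `U`: unit boxes on both sides, the same local term (§1)
      rw [show g (.inr pp) = 0 from if_neg hpp, add_zero,
        thetaLocal_settingPrVolSharp_inr_eq_of_norm_eq_at X hlog t (fun _ _ _ => 1) M archPk archSub Ψ act Mmod region n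
          lat sig split qData tq (fun _ _ => 1) ht0 htq0 htq1 (fun _ _ => one_ne_zero) (fun _ _ _ => norm_one) pp
          (fun i' x => by rw [hunit pp hpp i' x, norm_one]) (Setting.labelSucc i)]

/-- **`−|log(Θ)|(𝟙)` is a real number** (the trivial configuration has `ThetaFinite`). [claim: Mochizuki2012, status: disputed] -/
theorem negLogTheta_settingPrVolSharp_trivial_ne_top :
    (settingPrVolSharp X hlog M archPk archSub Ψ act Mmod region n lat sig split qData (fun _ _ => 1) (fun _ _ _ => 1)
        (fun _ _ => one_ne_zero) (fun _ _ _ => norm_one)).negLogTheta ≠ ⊤ := by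
  have hfinΘ₁ := thetaFinite_settingPrVolSharp X hlog M archPk archSub Ψ act Mmod region n lat sig split qData
    (fun _ _ _ => 1) (fun _ _ => 1) (fun _ _ _ => one_ne_zero) (fun _ _ _ _ => norm_one) (fun _ _ => one_ne_zero)
    (fun _ _ _ => norm_one)
  unfold Setting.negLogTheta
  rw [if_pos hfinΘ₁]
  exact WithTop.coe_ne_top

end Exact

end Real

end Thm311

end IUTFork

end Summit.ABC

end
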